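import Summits.QuantumFields.YangMills.Theorems.BalabanUVNodesN15CurvedGluingSpeciesCommutatorAdjoint
import Summits.QuantumFields.YangMills.Theorems.BalabanUVNodesN15TwoSpacingGluingDirichlet
import Summits.QuantumFields.YangMills.Theorems.BalabanUVNodesN15TwoSpacingGluingEntries
import Summits.QuantumFields.YangMills.Theorems.BalabanUVNodesN15BackgroundDressedInverse
import HarnessLib

/-!
# Route «BalabanUVNodes» (cluster K4 «SpineRates»), Track-A DAG node N15 = NE2, BACKGROUND LAYER — THE SPECIES OF A DIRICHLET CUBE: the compression of `Δ − V(c, a)` to a cube is the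
# compression of `Δ` minus a COMPRESSED SPECIES `V(c̃, ã)`, and the cube propagator `G_□(Δ − V) = M_χ(1 − N_□V(c̃, ã))⁻¹N_□M_χ` is M1's dressed pair around the cube resolvent `N_□` of
# `Δ` — its entries 0∕1 at a LIVE background from the flat cube's entries and the (3.35)–(3.37)-shaped species letters (the «perturbative device on cubes» dag-n15-c's gluing displays)

Cell `pub-ymgap`, seat `pub-ymgap-dag-n15-w3` (WIDTH SEAT 3∕3 on node N15, director-ym №197 ∕ HUMAN RULING D-0149; plan `W-SEAT-START-LIST.md` §n15 item 3 «the LG-vector + background layers at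
GENERAL small-field U» — sixteenth piece).  `bears_on: R4∕N15 · K3⁷ SpineGivenEndpointR13SepCoPH (stmt-QuantumFields-20544)`.  Filed `--supports stmt-QuantumFields-20544 --as helper` — COUNT-NEUTRAL.
Three plumbing `def`s (`cmprA`, `cmprC` — the compressed coefficients; `cubeRes` — the resolvent of dag-n15-c's Dirichlet compression `dirOp`), the rest theorems; 0 `sorry`.  Imports BY NAME file 12
`…N15CurvedGluingSpeciesCommutatorAdjoint` (file 14: `sum_abs_smul_row_le`; file 12 `mmulOp_comp_mulOp_fst`; FILE 28 `speciesOpM`, n15-b `mmulOp`∕`liftEquiv`∕`liftBlk`∕`hasMaj_mmulOp`), dag-n15-c FILE 47 `…N15TwoSpacingGluingDirichlet` (`dirOp`,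
`cubeInv`, `dirOp_inverse`, `mulOp_idem`, `hasMaj_localize`, `sandwich_in_out`, `hasMaj_localize_sandwich`), FILE 48 `…N15TwoSpacingGluingEntries` (`fgrad_comp_mulOp`, `bgrad_comp_mulOp`), dag-n15-c
`…N15BackgroundDressedInverse` (`sub_species_comp_dressed_eq_id`; M1 `bgPairM`, `projO_none_bgPairM`, `projO_some_bgPairM`, `hasMaj_unstackM`, B1a `isUnit_stepV`, `hasMaj_bgPropV`, B2 `stack`,
`projO`, `hasMaj_stack`, `hasMaj_projO_comp`); nothing in the tree is modified.

WHY.  dag-n15-c's [B6] gluing (FILES 43–55) reads the operator-layer NE2⁺ for a glued family off PER-CUBE letters of the Dirichlet cube propagators `G_□ = cubeInv Δ_a χ_□ =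
M_χ(χΔ_aχ + (1 − χ))⁻¹M_χ` (FILE 47) — and names as the one DISPLAYED analytic input without a tree producer «the cube inverses' plain (3.42)∕(2.133)-shaped majorants … (the lineage's
perturbative device on cubes in the cube's (3.35) gauge)» ([Balaban1985BackgroundPropagators] p. 399: the localized propagators are estimated «by using the regularity conditions (3.35) and
expanding with respect to A»).  At a live background the operator is `Δ_a = Δ − V(c, a)` with the first-order species of (3.52)–(3.53) (`Δ` = the flat part; FILE 28 `speciesOpM`).  THIS FILE
is that device at ONE grid: (§1) the Dirichlet compression of `Δ − V` is `dirOp Δ χ − M_χVM_χ`, and for an ι-constant cut-off `M_χVM_χ` is AGAIN a species, `V(c̃, ã)` with `ã⁺ = χ(χ∘τ)·a⁺`,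
`ã⁻ = χ(χ∘τ⁻¹)·a⁻`, `c̃ = χ²c + Σ_μ χ(∇⁺_μχ·a⁺_μ + ∇⁻_μχ·a⁻_μ)` — EXACT lattice algebra (the Leibniz rule `∇M_χ = M_{χ∘τ}∇ + M_{∇χ}` moves the right cut-off through the quotient);
(§2) hence M1's dressed pair around the cube RESOLVENT `N_□ = (dirOp Δ χ)⁻¹` (a genuine two-sided inverse on the whole lattice, FILE 47 `dirOp_inverse`) with the compressed coefficients
inverts `dirOp (Δ − V) χ` (dag-n15-c `sub_species_comp_dressed_eq_id`), so by uniqueness of the inverse `cubeInv (Δ − V) χ = M_χ∘X∘M_χ`, `X = pr₀(1 − N̂_□V̂(c̃, ã))⁻¹N̂_□` ((3.64) ON THE CUBE);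
(§3) the letters of `c̃, ã` from those of `c, a` and the cut-off (`|χ| ≤ 1`, `|∇^±χ| ≤ c_χ`); (§4) the cube propagator's ENTRIES 0∕1 at the live background, in dag-n15-c's localized
currency `1_S(y)1_S(y′)·K`, from the flat cube resolvent's entries `N_□, ∇^±N_□ ≤ βe^{−δd}`, the species letters and the ONE smallness `β·R·c_r < 1`, `R = (r_c + r_a + 2|J|c_χr_a)(1 + |J ⊕ J|)` —
B1a's Neumann-with-decay + FILE 47's localization from supports.

* §1 `dirOp_sub`; `mulOp_fst_mmulOp_mulOp_fst`, `mulOp_fst_mmulOp_fgrad_mulOp_fst`, `mulOp_fst_mmulOp_bgrad_mulOp_fst` (pointwise); defs `cmprA`, `cmprC`; ★★ `mulOp_comp_speciesOpM_comp_mulOp`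
  (`M_χ∘V(c, a)∘M_χ = V(c̃, ã)`), ★★ `dirOp_sub_speciesOpM` (`dirOp (Δ − V(c,a)) χ = dirOp Δ χ − V(c̃, ã)`);
* §2 def `cubeRes`; `cubeInv_eq_sandwich_cubeRes`, `dirOp_comp_cubeRes`, `fgrad_comp_dressed` ∕ `bgrad_comp_dressed` (the pair's derivative components ARE the quotients of `pr₀`), ★★★
  `cubeInv_sub_speciesOpM_eq` (`cubeInv (Δ − V(c,a)) χ = M_χ∘pr₀X̂∘M_χ`);
* §3 `abs_mul_le_one_of_le`, `rowSum_cmprA_le`, `rowSum_cmprC_le`;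
* §4 `hasMaj_bgPairM_cmpr` (the Neumann unit + B1a majorant of the pair with the compressed rows), ★★ `hasMaj_cubeInv_sub_speciesOpM` (entry 0: `G_□(Δ − V) ≤ 1_S1_S·β(1 − βRc_r)⁻¹e^{−ρd}`);
  entries 1 (`∇^±_μ∘G_□(Δ − V)`, through §2's `fgrad_comp_dressed`∕`bgrad_comp_dressed` + FILE 48 `fgrad_comp_mulOp`) = the successor file.

HONEST FRAMING ∕ LIMITS.  Finite-dimensional algebra + B1a's Neumann series with [B6] row sums ((3.52)–(3.53), (3.62)–(3.65) pp. 400–403, [B6] (2.52)–(2.56), (2.61), (2.133) = SHAPES ∕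
MECHANISM; nothing of [B6]∕[B9] asserted).  DISPLAYED: the flat cube resolvent's entries `N_□, ∇^±N_□ ≤ βe^{−δd}` (dag-n15-a PROGRAMME N ∕ dag-n15-e's King model are the tree's flat
cube objects; the identification is theirs), the two unit hypotheses (`dirOp Δ χ` a unit — FILE 47 `isUnit_dirOp_of_posDef`; the Neumann unit — B1a `isUnit_stepV` under the smallness, used
inside §4), the species letters in the cube's (3.35) gauge (file 3's gauge covariance relates gauges).  REGIME CAVEAT (located): for dag-n15-c's SHARP cut-off (`χ² = χ`) the letter
`c_χ = |∇^±χ|` equals `η⁻¹` on the cube's boundary layer, so §4's crude smallness `βRc_r < 1` (the step bounded by `β·R`, `R ∋ 2|J|c_χr_a`) asks `β·η⁻¹·r_a·c_r ≪ 1` — NOT the print's regime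
((3.35): `r_a = O(α₁)`, `β = O(1)`): there the boundary term `χ∇χ·a` of `c̃` is harmless because it is supported on a layer of width ONE SPACING which the flat resolvent integrates with weight
`η` (`N_□∘M_{1_∂} = O(η)`) — a BOUNDARY LETTER that position-independent block-sup letters do not carry; the successor's step-majorant edition (hypothesis on `N̂_□V̂(c̃, ã)` itself, bulk +
boundary letters) is the print-compatible form, and §1–§3 + `hasMaj_bgPairM_cmpr`'s shape are its bulk half verbatim.  NOT HERE: the RIGHT entries `G_□∇^±` (adjoint arrangement), the two-grid η-DEFECTS of
the cube propagator (the compressed coefficients' fits are O(1) on the cube's boundary layer of width one coarse spacing — a thin-layer argument, not a sup-letter, is needed there; successor ∕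
lanes), `Q*aQ`∕`DRD*` parts of `Δ_a`.  NE2⁺ NOT PRINTED, NOT proved; N15 NOT discharged; counts of record UNMOVED (typed 28∕28 · discharged 5∕27); one finite 𝕋⁴ at fixed ε — NOT infinite
volume, NOT OS on ℝ⁴, NOT a mass gap, NOT Clay; R4 closes the conditional finite-𝕋⁴ rung `BalabanLadder.UV` only.  Restate-immune (no Theses import).
-/

set_option autoImplicit false

noncomputable section
open scoped BigOperators
open Finset

namespace Summit.QuantumFields.YangMills.BalabanUVNodes.N15.CurvedSpecies

open Literature.MathematicalPhysics.QuantumFieldTheory.Balaban1983to89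
open Literature.MathematicalPhysics.QuantumFieldTheory.Balaban1983to89.B11SectG (BlockNorm HasMaj RowSum)
open Literature.MathematicalPhysics.QuantumFieldTheory.Balaban1983to89.T4EtaRateCoeffDefect (diagK diagK_nonneg hasMaj_mulOp)
open Literature.MathematicalPhysics.QuantumFieldTheory.Balaban1983to89.B6RandomWalk (Triangle254)
open Literature.MathematicalPhysics.QuantumFieldTheory.Balaban1983to89.B6Prop26Gluing (mulOp mulOp_apply ind ind_nonneg)
open Summit.QuantumFields.YangMills.BalabanUVNodes.N15.MatrixSpecies (mmulOp mmulOp_apply liftBlk liftEquiv liftEquiv_apply liftEquiv_symm_apply hasMaj_mmulOp)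
open Summit.QuantumFields.YangMills.BalabanUVNodes.N15.BackgroundLayer (fgrad bgrad fgrad_apply bgrad_apply speciesOpM linearMap_sum_comp mmulOp_add mmulOp_sum stack projO blkPair
  hasMaj_stack hasMaj_projO_comp unstackM bgPairM projO_none_bgPairM projO_some_bgPairM hasMaj_unstackM isUnit_stepV hasMaj_bgPropV sub_species_comp_dressed_eq_id)
open Summit.QuantumFields.YangMills.BalabanUVNodes.N15.BackgroundModel (kappa_ofBlocks)
open Summit.QuantumFields.YangMills.BalabanUVNodes.N15.Gluing (dirOp cubeInv dirOp_inverse mulOp_idem hasMaj_localize sandwich_in_out hasMaj_localize_sandwich hasMaj_diag_comp hasMaj_comp_diag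
  fgrad_comp_mulOp bgrad_comp_mulOp)

/-! ## §1 The Dirichlet compression of `Δ − V` and the compressed species -/

section Compression

variable {Y : Type}

/-- THE COMPRESSION IS ADDITIVE UP TO THE COMPLEMENT TERM: `dirOp (Δ − V) χ = dirOp Δ χ − M_χVM_χ`. [cite: Balaban1984PropagatorsII, pp.230–231 (operators restricted to cubes: shape)] -/
theorem dirOp_sub (Δ V : (Y → ℝ) →ₗ[ℝ] (Y → ℝ)) (χ : Y → ℝ) : dirOp (Δ - V) χ = dirOp Δ χ - mulOp χ ∘ₗ V ∘ₗ mulOp χ := by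
  simp only [dirOp, LinearMap.comp_sub, LinearMap.sub_comp]
  abel

variable {X ι J : Type} [Fintype ι]

/-- `M_χ∘M_C∘M_χ = M_{χ²C}` for an ι-constant cut-off. [folklore] -/
theorem mulOp_fst_mmulOp_mulOp_fst (χX : X → ℝ) (C : X → Matrix ι ι ℝ) :
    mulOp (fun p : X × ι => χX p.1) ∘ₗ mmulOp C ∘ₗ mulOp (fun p : X × ι => χX p.1) = mmulOp (fun x => (χX x * χX x) • C x) := by
  refine LinearMap.ext fun f => funext fun p => ?_
  simp only [LinearMap.comp_apply, mmulOp_apply, mulOp_apply, Matrix.smul_apply, smul_eq_mul, Finset.mul_sum]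
  exact Finset.sum_congr rfl fun j _ => by ring

/-- `M_χ∘(M_A∘∇⁺_e)∘M_χ = M_{χ(χ∘e)A}∘∇⁺_e + M_{χ(∇⁺_eχ)A}` — the right cut-off passes the forward quotient by the lattice Leibniz rule. [cite: Balaban1984PropagatorsI, (1.2)–(1.3) p.18 (shape)] -/
theorem mulOp_fst_mmulOp_fgrad_mulOp_fst (n : ℝ) (e : X ≃ X) (χX : X → ℝ) (A : X → Matrix ι ι ℝ) :
    mulOp (fun p : X × ι => χX p.1) ∘ₗ (mmulOp A ∘ₗ fgrad n (liftEquiv e ι)) ∘ₗ mulOp (fun p : X × ι => χX p.1) =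
      mmulOp (fun x => (χX x * χX (e x)) • A x) ∘ₗ fgrad n (liftEquiv e ι) + mmulOp (fun x => (χX x * fgrad n e χX x) • A x) := by
  refine LinearMap.ext fun f => funext fun p => ?_
  simp only [LinearMap.comp_apply, LinearMap.add_apply, Pi.add_apply, mmulOp_apply, mulOp_apply, fgrad_apply, liftEquiv_apply, Matrix.smul_apply, smul_eq_mul, Finset.mul_sum,
    ← Finset.sum_add_distrib]
  exact Finset.sum_congr rfl fun j _ => by ring

/-- `M_χ∘(M_A∘∇⁻_e)∘M_χ = M_{χ(χ∘e⁻¹)A}∘∇⁻_e + M_{χ(∇⁻_eχ)A}`. [cite: Balaban1984PropagatorsI, (1.2)–(1.3) p.18 (shape)] -/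
theorem mulOp_fst_mmulOp_bgrad_mulOp_fst (n : ℝ) (e : X ≃ X) (χX : X → ℝ) (A : X → Matrix ι ι ℝ) :
    mulOp (fun p : X × ι => χX p.1) ∘ₗ (mmulOp A ∘ₗ bgrad n (liftEquiv e ι)) ∘ₗ mulOp (fun p : X × ι => χX p.1) =
      mmulOp (fun x => (χX x * χX (e.symm x)) • A x) ∘ₗ bgrad n (liftEquiv e ι) + mmulOp (fun x => (χX x * bgrad n e χX x) • A x) := by
  refine LinearMap.ext fun f => funext fun p => ?_
  simp only [LinearMap.comp_apply, LinearMap.add_apply, Pi.add_apply, mmulOp_apply, mulOp_apply, bgrad_apply, liftEquiv_symm_apply, Matrix.smul_apply, smul_eq_mul, Finset.mul_sum,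
    ← Finset.sum_add_distrib]
  exact Finset.sum_congr rfl fun j _ => by ring

variable [Fintype J] (τ : J → X ≃ X) (n : ℝ) (χX : X → ℝ) (C : X → Matrix ι ι ℝ) (A : J ⊕ J → X → Matrix ι ι ℝ)

/-- THE COMPRESSED FIRST-ORDER COEFFICIENTS `ã⁺_μ = χ(χ∘τ_μ)·a⁺_μ`, `ã⁻_μ = χ(χ∘τ_μ⁻¹)·a⁻_μ` (the bonds of the species that stay inside the cube).
[cite: Balaban1985BackgroundPropagators, (3.52) p.400 (a: shape); Balaban1984PropagatorsII, pp.230–231 (restriction to cubes: shape)] -/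
def cmprA : J ⊕ J → X → Matrix ι ι ℝ :=
  Sum.elim (fun μ x => (χX x * χX (τ μ x)) • A (Sum.inl μ) x) (fun μ x => (χX x * χX ((τ μ).symm x)) • A (Sum.inr μ) x)

/-- THE COMPRESSED ZEROTH-ORDER COEFFICIENT `c̃ = χ²c + Σ_μ χ(∇⁺_μχ·a⁺_μ + ∇⁻_μχ·a⁻_μ)` (the cut-off's own quotients enter through the Leibniz rule).
[cite: Balaban1985BackgroundPropagators, (3.52) p.400 (c: shape); Balaban1984PropagatorsI, (1.2)–(1.3) p.18 (shape)] -/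
def cmprC : X → Matrix ι ι ℝ :=
  (fun x => (χX x * χX x) • C x) + ∑ μ, ((fun x => (χX x * fgrad n (τ μ) χX x) • A (Sum.inl μ) x) + fun x => (χX x * bgrad n (τ μ) χX x) • A (Sum.inr μ) x)

omit [Fintype ι] [Fintype J] in
/-- Unfolding (forward). [folklore] -/
@[simp] theorem cmprA_inl (μ : J) (x : X) : cmprA τ χX A (Sum.inl μ) x = (χX x * χX (τ μ x)) • A (Sum.inl μ) x := rfl

omit [Fintype ι] [Fintype J] in
/-- Unfolding (backward). [folklore] -/
@[simp] theorem cmprA_inr (μ : J) (x : X) : cmprA τ χX A (Sum.inr μ) x = (χX x * χX ((τ μ).symm x)) • A (Sum.inr μ) x := rfl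

omit [Fintype ι] in
/-- Unfolding of `c̃` at a point. [folklore] -/
theorem cmprC_apply (x : X) :
    cmprC τ n χX C A x = (χX x * χX x) • C x + ∑ μ, ((χX x * fgrad n (τ μ) χX x) • A (Sum.inl μ) x + (χX x * bgrad n (τ μ) χX x) • A (Sum.inr μ) x) := by
  simp only [cmprC, Pi.add_apply, Finset.sum_apply]

/-- ★★ **THE COMPRESSION OF A SPECIES IS A SPECIES**: `M_χ∘V(c, a)∘M_χ = V(c̃, ã)` for an ι-constant cut-off `χ = χ_X∘pr₁` — exact lattice algebra.
[cite: Balaban1985BackgroundPropagators, (3.52)–(3.53) p.400 (V: shape); Balaban1984PropagatorsII, pp.230–231 (restriction to cubes: shape)] -/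
theorem mulOp_comp_speciesOpM_comp_mulOp :
    mulOp (fun p : X × ι => χX p.1) ∘ₗ speciesOpM τ n C A ∘ₗ mulOp (fun p : X × ι => χX p.1) = speciesOpM τ n (cmprC τ n χX C A) (cmprA τ χX A) := by
  have hsum : mulOp (fun p : X × ι => χX p.1) ∘ₗ (∑ μ, (mmulOp (A (Sum.inl μ)) ∘ₗ fgrad n (liftEquiv (τ μ) ι) + mmulOp (A (Sum.inr μ)) ∘ₗ bgrad n (liftEquiv (τ μ) ι))) ∘ₗ
        mulOp (fun p : X × ι => χX p.1) =
      ∑ μ, (mulOp (fun p : X × ι => χX p.1) ∘ₗ (mmulOp (A (Sum.inl μ)) ∘ₗ fgrad n (liftEquiv (τ μ) ι)) ∘ₗ mulOp (fun p : X × ι => χX p.1) +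
        mulOp (fun p : X × ι => χX p.1) ∘ₗ (mmulOp (A (Sum.inr μ)) ∘ₗ bgrad n (liftEquiv (τ μ) ι)) ∘ₗ mulOp (fun p : X × ι => χX p.1)) := by
    refine LinearMap.ext fun f => ?_
    simp only [LinearMap.comp_apply, LinearMap.coe_sum, Finset.sum_apply, LinearMap.add_apply, map_sum, map_add]
  unfold speciesOpM
  rw [LinearMap.add_comp, LinearMap.comp_add, hsum, mulOp_fst_mmulOp_mulOp_fst, cmprC, mmulOp_add, mmulOp_sum, add_assoc, ← Finset.sum_add_distrib]
  congr 1
  refine Finset.sum_congr rfl fun μ _ => ?_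
  rw [mulOp_fst_mmulOp_fgrad_mulOp_fst, mulOp_fst_mmulOp_bgrad_mulOp_fst, mmulOp_add, cmprA_inl_fun, cmprA_inr_fun]
  abel
  where
  /-- the forward coefficient as a function -/
  cmprA_inl_fun (μ : J) : (fun x => (χX x * χX (τ μ x)) • A (Sum.inl μ) x) = cmprA τ χX A (Sum.inl μ) := rfl
  /-- the backward coefficient as a function -/
  cmprA_inr_fun (μ : J) : (fun x => (χX x * χX ((τ μ).symm x)) • A (Sum.inr μ) x) = cmprA τ χX A (Sum.inr μ) := rfl

/-- ★★ **THE DIRICHLET COMPRESSION OF `Δ − V(c, a)`**: `dirOp (Δ − V(c, a)) χ = dirOp Δ χ − V(c̃, ã)`. [cite: Balaban1984PropagatorsII, pp.230–231 (shape); Balaban1985BackgroundPropagators, (3.53) p.400 (shape)] -/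
theorem dirOp_sub_speciesOpM (Δ : (X × ι → ℝ) →ₗ[ℝ] (X × ι → ℝ)) :
    dirOp (Δ - speciesOpM τ n C A) (fun p : X × ι => χX p.1) = dirOp Δ (fun p : X × ι => χX p.1) - speciesOpM τ n (cmprC τ n χX C A) (cmprA τ χX A) := by
  rw [dirOp_sub, mulOp_comp_speciesOpM_comp_mulOp]

end Compression

/-! ## §2 The cube propagator of `Δ − V` is M1's dressed pair around the cube resolvent of `Δ` -/

section Dressed

variable {Y : Type} [Fintype Y] [DecidableEq Y]

/-- THE RESOLVENT OF THE DIRICHLET COMPRESSION `N_□ = (χΔχ + (1 − χ))⁻¹` as a linear map (FILE 47's `cubeInv Δ χ = M_χ∘N_□∘M_χ`). [cite: Balaban1984PropagatorsII, pp.230–231 (shape)] -/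
def cubeRes (Δ : (Y → ℝ) →ₗ[ℝ] (Y → ℝ)) (χ : Y → ℝ) : (Y → ℝ) →ₗ[ℝ] (Y → ℝ) := Matrix.toLin' (LinearMap.toMatrix' (dirOp Δ χ))⁻¹

/-- FILE 47's cube propagator through the resolvent. [folklore] -/
theorem cubeInv_eq_sandwich_cubeRes (Δ : (Y → ℝ) →ₗ[ℝ] (Y → ℝ)) (χ : Y → ℝ) : cubeInv Δ χ = mulOp χ ∘ₗ cubeRes Δ χ ∘ₗ mulOp χ := rfl

/-- The resolvent is a two-sided inverse of the compression under the unit hypothesis. [folklore] -/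
theorem dirOp_comp_cubeRes {Δ : (Y → ℝ) →ₗ[ℝ] (Y → ℝ)} {χ : Y → ℝ} (hunit : IsUnit (LinearMap.toMatrix' (dirOp Δ χ))) :
    dirOp Δ χ ∘ₗ cubeRes Δ χ = LinearMap.id ∧ cubeRes Δ χ ∘ₗ dirOp Δ χ = LinearMap.id := dirOp_inverse hunit

/-- UNIQUENESS OF THE INVERSE: a right inverse of an operator IS its resolvent. [folklore] -/
theorem cubeRes_eq_of_comp_eq_id {Δ T : (Y → ℝ) →ₗ[ℝ] (Y → ℝ)} {χ : Y → ℝ} (hT : dirOp Δ χ ∘ₗ T = LinearMap.id) : cubeRes Δ χ = T := by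
  have hM : LinearMap.toMatrix' (dirOp Δ χ) * LinearMap.toMatrix' T = 1 := by rw [← LinearMap.toMatrix'_comp, hT, LinearMap.toMatrix'_id]
  rw [cubeRes, Matrix.inv_eq_right_inv hM, Matrix.toLin'_toMatrix']

variable {X ι J : Type} [Fintype X] [DecidableEq X] [Fintype ι] [DecidableEq ι] [Fintype J] [DecidableEq J] (τ : J → X ≃ X) (n : ℝ)
  {N : (X × ι → ℝ) →ₗ[ℝ] (X × ι → ℝ)} {D : J ⊕ J → (X × ι → ℝ) →ₗ[ℝ] (X × ι → ℝ)} (C : X → Matrix ι ι ℝ) (A : J ⊕ J → X → Matrix ι ι ℝ)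

/-- THE FORWARD DERIVATIVE COMPONENT OF THE PAIR IS THE FORWARD QUOTIENT OF `pr₀`: `∇⁺_μ∘pr₀X̂ = pr_{⁺μ}X̂` when the derived pieces are the quotients of the piece (M1 `projO_none_bgPairM`,
`projO_some_bgPairM`). [cite: King1986, Prop. 3.9 (3.73) p.665 (derivative kernel: shape)] -/
theorem fgrad_comp_dressed (hDf : ∀ μ, D (Sum.inl μ) = fgrad n (liftEquiv (τ μ) ι) ∘ₗ N) (hunit : IsUnit (1 - LinearMap.toMatrix' (stack N D ∘ₗ unstackM C A))) (μ : J) :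
    fgrad n (liftEquiv (τ μ) ι) ∘ₗ (projO none ∘ₗ bgPairM N D C A) = projO (some (Sum.inl μ)) ∘ₗ bgPairM N D C A := by
  rw [projO_none_bgPairM hunit, projO_some_bgPairM hunit, LinearMap.comp_add, ← LinearMap.comp_assoc, ← hDf]

/-- THE BACKWARD DERIVATIVE COMPONENT: `∇⁻_μ∘pr₀X̂ = pr_{⁻μ}X̂`. [cite: King1986, Prop. 3.9 (3.73) p.665 (shape)] -/
theorem bgrad_comp_dressed (hDb : ∀ μ, D (Sum.inr μ) = bgrad n (liftEquiv (τ μ) ι) ∘ₗ N) (hunit : IsUnit (1 - LinearMap.toMatrix' (stack N D ∘ₗ unstackM C A))) (μ : J) :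
    bgrad n (liftEquiv (τ μ) ι) ∘ₗ (projO none ∘ₗ bgPairM N D C A) = projO (some (Sum.inr μ)) ∘ₗ bgPairM N D C A := by
  rw [projO_none_bgPairM hunit, projO_some_bgPairM hunit, LinearMap.comp_add, ← LinearMap.comp_assoc, ← hDb]

variable (χX : X → ℝ)

/-- ★★★ **THE CUBE PROPAGATOR OF `Δ − V` IS THE DRESSED PAIR AROUND THE CUBE RESOLVENT OF `Δ`** ((3.64) on a Dirichlet cube): with `N_□ = cubeRes Δ χ` a unit-resolvent, the derived pieces
`D^±_μ = ∇^±_μ∘N_□`, the compressed coefficients `c̃, ã` and the Neumann unit, `cubeInv (Δ − V(c, a)) χ = M_χ ∘ pr₀(1 − N̂_□V̂(c̃, ã))⁻¹N̂_□ ∘ M_χ`.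
[cite: Balaban1985BackgroundPropagators, (3.62)–(3.65) pp.402–403 (mechanism); Balaban1984PropagatorsII, pp.230–231, (2.91) p.239 («G_□»: shape)] -/
theorem cubeInv_sub_speciesOpM_eq (Δ : (X × ι → ℝ) →ₗ[ℝ] (X × ι → ℝ)) (hunit₀ : IsUnit (LinearMap.toMatrix' (dirOp Δ (fun p : X × ι => χX p.1))))
    (hN : N = cubeRes Δ (fun p : X × ι => χX p.1)) (hDf : ∀ μ, D (Sum.inl μ) = fgrad n (liftEquiv (τ μ) ι) ∘ₗ N) (hDb : ∀ μ, D (Sum.inr μ) = bgrad n (liftEquiv (τ μ) ι) ∘ₗ N)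
    (hunit : IsUnit (1 - LinearMap.toMatrix' (stack N D ∘ₗ unstackM (cmprC τ n χX C A) (cmprA τ χX A)))) :
    cubeInv (Δ - speciesOpM τ n C A) (fun p : X × ι => χX p.1) =
      mulOp (fun p : X × ι => χX p.1) ∘ₗ (projO none ∘ₗ bgPairM N D (cmprC τ n χX C A) (cmprA τ χX A)) ∘ₗ mulOp (fun p : X × ι => χX p.1) := by
  have hΔN : dirOp Δ (fun p : X × ι => χX p.1) ∘ₗ N = LinearMap.id := by rw [hN]; exact (dirOp_comp_cubeRes hunit₀).1
  have hinv := sub_species_comp_dressed_eq_id τ n N (cmprC τ n χX C A) (cmprA τ χX A) (dirOp Δ (fun p : X × ι => χX p.1)) hΔN hDf hDb hunit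
  rw [← dirOp_sub_speciesOpM] at hinv
  rw [cubeInv_eq_sandwich_cubeRes, cubeRes_eq_of_comp_eq_id hinv]

end Dressed

/-! ## §3 The letters of the compressed coefficients -/

section Letters

variable {X ι J : Type} [Fintype ι] [Fintype J] (τ : J → X ≃ X) (n : ℝ) {χX : X → ℝ} {C : X → Matrix ι ι ℝ} {A : J ⊕ J → X → Matrix ι ι ℝ}

omit [Fintype ι] [Fintype J] in
/-- `|χ(x)χ(x′)| ≤ 1` for a cut-off bounded by one. [folklore] -/
theorem abs_mul_le_one_of_le (hχ : ∀ x, |χX x| ≤ 1) (x x' : X) : |χX x * χX x'| ≤ 1 := by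
  rw [abs_mul]
  calc |χX x| * |χX x'| ≤ 1 * 1 := mul_le_mul (hχ x) (hχ x') (abs_nonneg _) zero_le_one
    _ = 1 := one_mul 1

omit [Fintype J] in
/-- THE COMPRESSED FIRST-ORDER ROWS do not exceed the original ones: `Σ_k|ã^±_μ(x)_{ik}| ≤ r_a`. [cite: Balaban1985BackgroundPropagators, (3.35) p.396 (shape)] -/
theorem rowSum_cmprA_le {rA : ℝ} (hχ : ∀ x, |χX x| ≤ 1) (hA : ∀ j x i, ∑ k, |A j x i k| ≤ rA) (j : J ⊕ J) (x : X) (i : ι) : ∑ k, |cmprA τ χX A j x i k| ≤ rA := by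
  cases j with
  | inl μ => simpa only [cmprA_inl, one_mul] using sum_abs_smul_row_le zero_le_one (abs_mul_le_one_of_le hχ x (τ μ x)) i (hA (Sum.inl μ) x i)
  | inr μ => simpa only [cmprA_inr, one_mul] using sum_abs_smul_row_le zero_le_one (abs_mul_le_one_of_le hχ x ((τ μ).symm x)) i (hA (Sum.inr μ) x i)

/-- THE COMPRESSED ZEROTH-ORDER ROWS: `Σ_k|c̃(x)_{ik}| ≤ r_c + |J|·2c_χr_a` from `|χ| ≤ 1`, `|∇^±_μχ| ≤ c_χ`, `Σ_k|c_{ik}| ≤ r_c`, `Σ_k|a_{ik}| ≤ r_a`.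
[cite: Balaban1985BackgroundPropagators, (3.35) p.396 (shape); Balaban1984PropagatorsII, p.229 («|∂h| ≤ O(1)(ML^jη)^{−1}»: the cut-off's quotient as a letter, shape)] -/
theorem rowSum_cmprC_le {rC rA cχ : ℝ} (hcχ : 0 ≤ cχ) (hχ : ∀ x, |χX x| ≤ 1) (hdχ : ∀ μ x, |fgrad n (τ μ) χX x| ≤ cχ) (hdχb : ∀ μ x, |bgrad n (τ μ) χX x| ≤ cχ)
    (hC : ∀ x i, ∑ k, |C x i k| ≤ rC) (hA : ∀ j x i, ∑ k, |A j x i k| ≤ rA) (x : X) (i : ι) :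
    ∑ k, |cmprC τ n χX C A x i k| ≤ rC + Fintype.card J * (2 * (cχ * rA)) := by
  have hw1 : ∀ μ, |χX x * fgrad n (τ μ) χX x| ≤ cχ := fun μ => by
    rw [abs_mul]
    calc |χX x| * |fgrad n (τ μ) χX x| ≤ 1 * cχ := mul_le_mul (hχ x) (hdχ μ x) (abs_nonneg _) zero_le_one
      _ = cχ := one_mul cχ
  have hw2 : ∀ μ, |χX x * bgrad n (τ μ) χX x| ≤ cχ := fun μ => by
    rw [abs_mul]
    calc |χX x| * |bgrad n (τ μ) χX x| ≤ 1 * cχ := mul_le_mul (hχ x) (hdχb μ x) (abs_nonneg _) zero_le_one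
      _ = cχ := one_mul cχ
  have h0 : ∑ k, |((χX x * χX x) • C x) i k| ≤ rC := by simpa only [one_mul] using sum_abs_smul_row_le zero_le_one (abs_mul_le_one_of_le hχ x x) i (hC x i)
  have hμ : ∀ μ, ∑ k, |(((χX x * fgrad n (τ μ) χX x) • A (Sum.inl μ) x) + ((χX x * bgrad n (τ μ) χX x) • A (Sum.inr μ) x)) i k| ≤ 2 * (cχ * rA) := fun μ => by
    calc ∑ k, |(((χX x * fgrad n (τ μ) χX x) • A (Sum.inl μ) x) + ((χX x * bgrad n (τ μ) χX x) • A (Sum.inr μ) x)) i k|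
        ≤ ∑ k, (|((χX x * fgrad n (τ μ) χX x) • A (Sum.inl μ) x) i k| + |((χX x * bgrad n (τ μ) χX x) • A (Sum.inr μ) x) i k|) :=
          Finset.sum_le_sum fun k _ => by rw [Matrix.add_apply]; exact abs_add_le _ _
      _ ≤ cχ * rA + cχ * rA := by
          rw [Finset.sum_add_distrib]
          exact add_le_add (sum_abs_smul_row_le hcχ (hw1 μ) i (hA _ x i)) (sum_abs_smul_row_le hcχ (hw2 μ) i (hA _ x i))
      _ = 2 * (cχ * rA) := by ring
  have hsa : ∀ k, |(∑ μ, (((χX x * fgrad n (τ μ) χX x) • A (Sum.inl μ) x) + ((χX x * bgrad n (τ μ) χX x) • A (Sum.inr μ) x))) i k| ≤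
      ∑ μ, |(((χX x * fgrad n (τ μ) χX x) • A (Sum.inl μ) x) + ((χX x * bgrad n (τ μ) χX x) • A (Sum.inr μ) x)) i k| := fun k => by
    rw [Matrix.sum_apply]
    exact Finset.abs_sum_le_sum_abs _ _
  calc ∑ k, |cmprC τ n χX C A x i k|
      = ∑ k, |((χX x * χX x) • C x) i k + (∑ μ, (((χX x * fgrad n (τ μ) χX x) • A (Sum.inl μ) x) + ((χX x * bgrad n (τ μ) χX x) • A (Sum.inr μ) x))) i k| :=
        Finset.sum_congr rfl fun k _ => by rw [cmprC_apply, Matrix.add_apply]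
    _ ≤ ∑ k, (|((χX x * χX x) • C x) i k| + ∑ μ, |(((χX x * fgrad n (τ μ) χX x) • A (Sum.inl μ) x) + ((χX x * bgrad n (τ μ) χX x) • A (Sum.inr μ) x)) i k|) :=
        Finset.sum_le_sum fun k _ => (abs_add_le _ _).trans (add_le_add le_rfl (hsa k))
    _ = ∑ k, |((χX x * χX x) • C x) i k| + ∑ μ, ∑ k, |(((χX x * fgrad n (τ μ) χX x) • A (Sum.inl μ) x) + ((χX x * bgrad n (τ μ) χX x) • A (Sum.inr μ) x)) i k| := by
        rw [Finset.sum_add_distrib, Finset.sum_comm]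
    _ ≤ rC + ∑ _μ : J, 2 * (cχ * rA) := add_le_add h0 (Finset.sum_le_sum fun μ _ => hμ μ)
    _ = rC + Fintype.card J * (2 * (cχ * rA)) := by rw [Finset.sum_const, Finset.card_univ, nsmul_eq_mul]

end Letters

/-! ## §4 The cube propagator's entries 0∕1 at a live background from the flat cube resolvent's entries -/

section Rows

variable {X ι J : Type} [Fintype X] [DecidableEq X] [Fintype ι] [DecidableEq ι] [Fintype J] [DecidableEq J] {g : B6.Geometry} (blk : X → g.Site)
  (τ : J → X ≃ X) (n : ℝ) (χX : X → ℝ) (C : X → Matrix ι ι ℝ) (A : J ⊕ J → X → Matrix ι ι ℝ) (Δ : (X × ι → ℝ) →ₗ[ℝ] (X × ι → ℝ)) {σ cr : ℝ}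

/-- The majorant of the dressed pair around the cube resolvent with the compressed coefficients (B1a `hasMaj_bgPropV` with B2 `hasMaj_stack` and M1 `hasMaj_unstackM` at the compressed
rows of §3), and its Neumann unit (B1a `isUnit_stepV`). [cite: Balaban1985BackgroundPropagators, (3.64) p.403 (mechanism); Balaban1984PropagatorsII, (2.52)–(2.56) pp.232–233, (2.61) p.234] -/
theorem hasMaj_bgPairM_cmpr (htri : Triangle254 g) (hd : ∀ a b : g.Site, 0 ≤ g.dist a b) (hrow : RowSum g σ cr) (hσ : 0 ≤ σ) {ρ δ β rC rA cχ : ℝ} (hρ : 0 ≤ ρ) (hρδ : ρ + σ ≤ δ)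
    (hβ : 0 ≤ β) (hrC : 0 ≤ rC) (hrA : 0 ≤ rA) (hcχ : 0 ≤ cχ) (hχ : ∀ x, |χX x| ≤ 1) (hdχ : ∀ μ x, |fgrad n (τ μ) χX x| ≤ cχ) (hdχb : ∀ μ x, |bgrad n (τ μ) χX x| ≤ cχ)
    (hC : ∀ x i, ∑ k, |C x i k| ≤ rC) (hA : ∀ j x i, ∑ k, |A j x i k| ≤ rA)
    (hN : HasMaj (BlockNorm.ofBlocks g (liftBlk blk ι)) (BlockNorm.ofBlocks g (liftBlk blk ι)) (cubeRes Δ (fun p : X × ι => χX p.1)) (fun y y' => β * Real.exp (-(δ * g.dist y y'))))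
    (hDN : ∀ μ, HasMaj (BlockNorm.ofBlocks g (liftBlk blk ι)) (BlockNorm.ofBlocks g (liftBlk blk ι)) (fgrad n (liftEquiv (τ μ) ι) ∘ₗ cubeRes Δ (fun p : X × ι => χX p.1))
      (fun y y' => β * Real.exp (-(δ * g.dist y y'))))
    (hDNb : ∀ μ, HasMaj (BlockNorm.ofBlocks g (liftBlk blk ι)) (BlockNorm.ofBlocks g (liftBlk blk ι)) (bgrad n (liftEquiv (τ μ) ι) ∘ₗ cubeRes Δ (fun p : X × ι => χX p.1))
      (fun y y' => β * Real.exp (-(δ * g.dist y y'))))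
    (hq : β * ((rC + rA + Fintype.card J * (2 * (cχ * rA))) * (1 + Fintype.card (J ⊕ J))) * cr < 1) :
    IsUnit (1 - LinearMap.toMatrix' (stack (cubeRes Δ (fun p : X × ι => χX p.1))
        (Sum.elim (fun μ => fgrad n (liftEquiv (τ μ) ι) ∘ₗ cubeRes Δ (fun p : X × ι => χX p.1)) (fun μ => bgrad n (liftEquiv (τ μ) ι) ∘ₗ cubeRes Δ (fun p : X × ι => χX p.1))) ∘ₗ
        unstackM (cmprC τ n χX C A) (cmprA τ χX A))) ∧
      HasMaj (BlockNorm.ofBlocks g (liftBlk blk ι)) (BlockNorm.ofBlocks g (blkPair (liftBlk blk ι)))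
        (bgPairM (cubeRes Δ (fun p : X × ι => χX p.1))
          (Sum.elim (fun μ => fgrad n (liftEquiv (τ μ) ι) ∘ₗ cubeRes Δ (fun p : X × ι => χX p.1)) (fun μ => bgrad n (liftEquiv (τ μ) ι) ∘ₗ cubeRes Δ (fun p : X × ι => χX p.1)))
          (cmprC τ n χX C A) (cmprA τ χX A))
        (fun y y' => β * (1 - β * ((rC + rA + Fintype.card J * (2 * (cχ * rA))) * (1 + Fintype.card (J ⊕ J))) * cr)⁻¹ * Real.exp (-(ρ * g.dist y y'))) := by
  have hR0 : 0 ≤ rC + rA + Fintype.card J * (2 * (cχ * rA)) := by positivity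
  have hCt : ∀ x i, ∑ k, |cmprC τ n χX C A x i k| ≤ rC + rA + Fintype.card J * (2 * (cχ * rA)) := fun x i =>
    (rowSum_cmprC_le τ n hcχ hχ hdχ hdχb hC hA x i).trans (by linarith)
  have hJ0 : (0 : ℝ) ≤ Fintype.card J * (2 * (cχ * rA)) := by positivity
  have hAt : ∀ j x i, ∑ k, |cmprA τ χX A j x i k| ≤ rC + rA + Fintype.card J * (2 * (cχ * rA)) := fun j x i =>
    (rowSum_cmprA_le τ hχ hA j x i).trans (by linarith)
  have hV := hasMaj_unstackM (g := g) blk (J := J ⊕ J) hR0 hCt hAt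
  have hD : ∀ j, HasMaj (BlockNorm.ofBlocks g (liftBlk blk ι)) (BlockNorm.ofBlocks g (liftBlk blk ι))
      (Sum.elim (fun μ => fgrad n (liftEquiv (τ μ) ι) ∘ₗ cubeRes Δ (fun p : X × ι => χX p.1)) (fun μ => bgrad n (liftEquiv (τ μ) ι) ∘ₗ cubeRes Δ (fun p : X × ι => χX p.1)) j)
      (fun y y' => β * Real.exp (-(δ * g.dist y y'))) := fun j => by
    cases j with
    | inl μ => exact hDN μ
    | inr μ => exact hDNb μ
  have hS := hasMaj_stack (liftBlk blk ι) (fun _ _ => mul_nonneg hβ (Real.exp_nonneg _)) hN hD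
  have hσδ : σ ≤ δ := by linarith
  exact ⟨isUnit_stepV (liftBlk blk ι) (blkPair (liftBlk blk ι)) hd hrow hσδ hβ (mul_nonneg hR0 (by positivity)) hS hV hq,
    hasMaj_bgPropV (liftBlk blk ι) (blkPair (liftBlk blk ι)) htri hd hrow hσ hρ hρδ hβ (mul_nonneg hR0 (by positivity)) hS hV hq⟩

/-- ★★ **ENTRY 0 OF THE CUBE PROPAGATOR AT A LIVE BACKGROUND — «expanding with respect to A».**  Data: the flat cube resolvent `N_□ = cubeRes Δ χ` (`dirOp Δ χ` a unit) with entries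
`N_□, ∇^±_μN_□ ≤ βe^{−δd}`; an ι-constant idempotent cut-off `χ = χ_X∘pr₁` (`χ_X² = χ_X`, `|χ_X| ≤ 1`, `|∇^±χ_X| ≤ c_χ`) whose support lies over the block set `S`; species letters `Σ_k|c_{ik}| ≤ r_c`,
`Σ_k|a^±_{ik}| ≤ r_a`; `R := (r_c + r_a + 2|J|c_χr_a)(1 + |J ⊕ J|)`, `0 ≤ ρ`, `ρ + σ ≤ δ`, the ONE smallness `βRc_r < 1`.  Then
`cubeInv (Δ − V(c, a)) χ ≤ 1_S(y)1_S(y′)·β(1 − βRc_r)⁻¹·e^{−ρd}`. [cite: Balaban1985BackgroundPropagators, p.399 («using the regularity conditions (3.35) and expanding with respect to A»), (3.62)–(3.65) pp.402–403 (mechanism); Balaban1984PropagatorsII, (2.133) p.247 (shape)] -/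
theorem hasMaj_cubeInv_sub_speciesOpM (htri : Triangle254 g) (hd : ∀ a b : g.Site, 0 ≤ g.dist a b) (hrow : RowSum g σ cr) (hσ : 0 ≤ σ) {ρ δ β rC rA cχ : ℝ} (hρ : 0 ≤ ρ)
    (hρδ : ρ + σ ≤ δ) (hβ : 0 ≤ β) (hrC : 0 ≤ rC) (hrA : 0 ≤ rA) (hcχ : 0 ≤ cχ) {S : Set g.Site} (hχ2 : χX * χX = χX) (hχ : ∀ x, |χX x| ≤ 1)
    (hdχ : ∀ μ x, |fgrad n (τ μ) χX x| ≤ cχ) (hdχb : ∀ μ x, |bgrad n (τ μ) χX x| ≤ cχ) (hS : ∀ x, χX x ≠ 0 → blk x ∈ S) (hC : ∀ x i, ∑ k, |C x i k| ≤ rC)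
    (hA : ∀ j x i, ∑ k, |A j x i k| ≤ rA) (hunit₀ : IsUnit (LinearMap.toMatrix' (dirOp Δ (fun p : X × ι => χX p.1))))
    (hN : HasMaj (BlockNorm.ofBlocks g (liftBlk blk ι)) (BlockNorm.ofBlocks g (liftBlk blk ι)) (cubeRes Δ (fun p : X × ι => χX p.1)) (fun y y' => β * Real.exp (-(δ * g.dist y y'))))
    (hDN : ∀ μ, HasMaj (BlockNorm.ofBlocks g (liftBlk blk ι)) (BlockNorm.ofBlocks g (liftBlk blk ι)) (fgrad n (liftEquiv (τ μ) ι) ∘ₗ cubeRes Δ (fun p : X × ι => χX p.1))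
      (fun y y' => β * Real.exp (-(δ * g.dist y y'))))
    (hDNb : ∀ μ, HasMaj (BlockNorm.ofBlocks g (liftBlk blk ι)) (BlockNorm.ofBlocks g (liftBlk blk ι)) (bgrad n (liftEquiv (τ μ) ι) ∘ₗ cubeRes Δ (fun p : X × ι => χX p.1))
      (fun y y' => β * Real.exp (-(δ * g.dist y y'))))
    (hq : β * ((rC + rA + Fintype.card J * (2 * (cχ * rA))) * (1 + Fintype.card (J ⊕ J))) * cr < 1) :
    HasMaj (BlockNorm.ofBlocks g (liftBlk blk ι)) (BlockNorm.ofBlocks g (liftBlk blk ι)) (cubeInv (Δ - speciesOpM τ n C A) (fun p : X × ι => χX p.1))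
      (fun y y' => ind S y * ind S y' * (β * (1 - β * ((rC + rA + Fintype.card J * (2 * (cχ * rA))) * (1 + Fintype.card (J ⊕ J))) * cr)⁻¹ * Real.exp (-(ρ * g.dist y y')))) := by
  obtain ⟨hunit, hX⟩ := hasMaj_bgPairM_cmpr blk τ n χX C A Δ htri hd hrow hσ hρ hρδ hβ hrC hrA hcχ hχ hdχ hdχb hC hA hN hDN hDNb hq
  have hβX : 0 ≤ β * (1 - β * ((rC + rA + Fintype.card J * (2 * (cχ * rA))) * (1 + Fintype.card (J ⊕ J))) * cr)⁻¹ :=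
    mul_nonneg hβ (inv_nonneg.2 (by linarith))
  have hX0 := hasMaj_projO_comp (liftBlk blk ι) hX none
  have hχ2p : (fun p : X × ι => χX p.1) * (fun p : X × ι => χX p.1) = fun p : X × ι => χX p.1 := funext fun p => by
    have := congrArg (fun f => f p.1) hχ2
    simpa only [Pi.mul_apply] using this
  have hMχ := hasMaj_mulOp (g := g) (liftBlk blk ι) (m := fun _ => (1 : ℝ)) (fun _ => zero_le_one) (fun p : X × ι => hχ p.1)
  -- the sandwich `M_χ X M_χ`: diagonal factors cost nothing
  have hT : HasMaj (BlockNorm.ofBlocks g (liftBlk blk ι)) (BlockNorm.ofBlocks g (liftBlk blk ι))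
      (mulOp (fun p : X × ι => χX p.1) ∘ₗ
        (projO none ∘ₗ bgPairM (cubeRes Δ (fun p : X × ι => χX p.1))
          (Sum.elim (fun μ => fgrad n (liftEquiv (τ μ) ι) ∘ₗ cubeRes Δ (fun p : X × ι => χX p.1)) (fun μ => bgrad n (liftEquiv (τ μ) ι) ∘ₗ cubeRes Δ (fun p : X × ι => χX p.1)))
          (cmprC τ n χX C A) (cmprA τ χX A)) ∘ₗ mulOp (fun p : X × ι => χX p.1))
      (fun y y' => β * (1 - β * ((rC + rA + Fintype.card J * (2 * (cχ * rA))) * (1 + Fintype.card (J ⊕ J))) * cr)⁻¹ * Real.exp (-(ρ * g.dist y y'))) := by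
    have t := hasMaj_diag_comp (liftBlk blk ι) (fun _ => zero_le_one) hMχ (hasMaj_comp_diag (liftBlk blk ι) (fun _ _ => mul_nonneg hβX (Real.exp_nonneg _)) hX0 hMχ)
    refine t.mono fun y y' => le_of_eq ?_
    ring
  rw [cubeInv_sub_speciesOpM_eq τ n C A χX Δ hunit₀ rfl (fun _ => rfl) (fun _ => rfl) hunit]
  refine hasMaj_localize_sandwich (liftBlk blk ι) (liftBlk blk ι) (fun _ _ => mul_nonneg hβX (Real.exp_nonneg _)) ?_ (fun p hp => hS p.1 hp) (fun p hp => hS p.1 hp) hT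
  -- `M_χ(M_χ T M_χ)M_χ = M_χ T M_χ` for the idempotent cut-off
  simp only [LinearMap.comp_assoc]
  rw [mulOp_idem hχ2p, ← LinearMap.comp_assoc, mulOp_idem hχ2p]

end Rows

end Summit.QuantumFields.YangMills.BalabanUVNodes.N15.CurvedSpecies

end
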